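import Literature.NumberTheory.LFunctions.DirichletLTruncationCertificates
import HarnessLib

/-!
# No real zero for the EVEN real primitive characters of conductor `951 ≤ q ≤ 1000`, in the kernel
# (Davenport–Chua truncation certificates)

Topic `Literature/NumberTheory/LFunctions`; namespace `Literature.NumberTheory.LFunctions`
(private per-modulus work in `Literature.NumberTheory.LFunctions.EvenTruncationVIb`). THEOREMS only (no
definition, no named fact, no `sorry`): **`noRealZeroEven_range_951_1000`** — for every modulus
`951 ≤ q ≤ 1000`, every primitive quadratic EVEN `χ` mod `q` and every `σ ∈ (0, 1)`, `L(σ, χ) ≠ 0`.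

Per modulus (one bullet each, in the order of `interval_cases`): moduli without a primitive quadratic
character are dismissed (`q ≡ 2 (mod 4)`, `16 ∣ q`, `p² ∣ q` — MV Thm 9.13); the ODD primitive quadratic
character is excluded by the parity test inside `LTruncationCert.good_even_of_*`; the EVEN one (real
quadratic field of discriminant `q`) is certified by **`LTruncationCert.certOK v q 16 32`**
(`DirichletLTruncationCertificates.lean`): the one-period truncation `∑_{n ≤ q} χ(n) n^{−σ}` dominates the
second-order tail bound `B/(2(q+1)^{3/2})` on each of `16` cells covering `[1/2, 1]` (fixed point `2^{−32}`,
roots by bisection in the kernel), and the functional equation reflects `(0, 1/2)` to `(1/2, 1)`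
(`DirichletLTruncationBound.lean`). 14 certificates in this file; `B = max_N |∑_{K ≤ N} S(K)|` and the
worst cell margin of each are recorded in the bullets. [cite: Chua2005RealZeros, §2.2 ALGO 1]

## References

* K. S. Chua, *Real zeros of Dedekind zeta functions of real quadratic fields*, Math. Comp. 74 (2005)
  1457–1470, §2. [Chua2005RealZeros]
* H. L. Montgomery, R. C. Vaughan, *Multiplicative Number Theory I*, CUP 2007, §9.3 Thm 9.13, §10.1.
  [MontgomeryVaughan2007]
-/

namespace Literature.NumberTheory.LFunctions

namespace EvenTruncationVIb

open FeketePolyaKernel PrimitiveQuadratic LTruncationCert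

/-- Conductor `≡ 2 (mod 4)`: no primitive character (private copy of the sweep-4 lemma).
[cite: MontgomeryVaughan2007, §9.3 Theorem 9.13] -/
private theorem absurd_of_mod_four_two {q : ℕ} [NeZero q] (hq : q % 4 = 2)
    {χ : DirichletCharacter ℂ q} (hprim : χ.IsPrimitive) : False := by
  obtain ⟨m, rfl⟩ : ∃ m, q = 2 * m := ⟨q / 2, by omega⟩
  haveI : NeZero m := ⟨by omega⟩
  exact not_isPrimitive_two_mul (m := m) (Nat.odd_iff.mpr (by omega)) hprim

/-- Conductor divisible by `16`: no primitive quadratic character (private copy).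
[cite: MontgomeryVaughan2007, §9.3 Theorem 9.13] -/
private theorem absurd_of_sixteen_dvd {q : ℕ} [NeZero q] (hq : q % 16 = 0) {χ : DirichletCharacter ℂ q}
    (hprim : χ.IsPrimitive) (hquad : χ.IsQuadratic) : False := by
  obtain ⟨k, m, hm, rfl⟩ := Nat.exists_eq_two_pow_mul_odd (NeZero.ne q)
  have hm2 := Nat.odd_iff.mp hm
  haveI : NeZero m := ⟨by omega⟩
  have hk := le_three_of_level_two_pow_mul hm hprim hquad
  interval_cases k <;> norm_num at hq <;> omega

/-- Conductor with an odd square factor `p²`: no primitive quadratic character (private copy).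
[cite: MontgomeryVaughan2007, §9.3 Theorem 9.13] -/
private theorem absurd_of_sq_dvd {q : ℕ} [NeZero q] {p : ℕ} (hp : p.Prime) (hp2 : p ≠ 2)
    (hpq : p * p ∣ q) {χ : DirichletCharacter ℂ q} (hprim : χ.IsPrimitive) (hquad : χ.IsQuadratic) :
    False := by
  obtain ⟨k, m, hm, rfl⟩ := Nat.exists_eq_two_pow_mul_odd (NeZero.ne q)
  have hm2 := Nat.odd_iff.mp hm
  haveI : NeZero m := ⟨by omega⟩
  have hsq := squarefree_of_level_two_pow_mul hm hprim hquad
  have hp2' : Nat.Coprime p 2 := (Nat.coprime_primes hp Nat.prime_two).mpr hp2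
  have hcop : Nat.Coprime (p * p) (2 ^ k) := Nat.Coprime.pow_right k (Nat.Coprime.mul_left hp2' hp2')
  have hpm : p * p ∣ m := hcop.dvd_of_dvd_mul_left hpq
  exact hp.one_lt.ne' (Nat.isUnit_iff.mp (hsq p hpm))

/-- `952 = 8·119`: the even character `χ₋₈·(·/119)` — truncation certificate `J = 16`, `P = 32` (`B = 3216`, worst cell margin `1.009`); the other primitive quadratic character mod `952` is odd (parity test). [cite: Chua2005RealZeros, §2.2 ALGO 1] -/
private theorem good952 :
    ∀ χ : DirichletCharacter ℂ 952, χ.IsQuadratic → χ.IsPrimitive → χ.Even →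
      ∀ σ : ℝ, 0 < σ → σ < 1 → χ.LFunction σ ≠ 0 :=
  good_even_of_eight (by decide) (by decide) 16 32 (by decide +kernel) (by decide +kernel)

/-- `953`: the even character `(·/953)` — truncation certificate `J = 16`, `P = 32` (`B = 3077`, worst cell margin `1.135`). [cite: Chua2005RealZeros, §2.2 ALGO 1] -/
private theorem good953 :
    ∀ χ : DirichletCharacter ℂ 953, χ.IsQuadratic → χ.IsPrimitive → χ.Even →
      ∀ σ : ℝ, 0 < σ → σ < 1 → χ.LFunction σ ≠ 0 :=
  good_even_of_odd (by decide) (by decide) 16 32 (by decide +kernel)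

/-- `956 = 4·239`: the even character `χ₋₄·(·/239)` — truncation certificate `J = 16`, `P = 32` (`B = 2848`, worst cell margin `0.812`). [cite: Chua2005RealZeros, §2.2 ALGO 1] -/
private theorem good956 :
    ∀ χ : DirichletCharacter ℂ 956, χ.IsQuadratic → χ.IsPrimitive → χ.Even →
      ∀ σ : ℝ, 0 < σ → σ < 1 → χ.LFunction σ ≠ 0 :=
  good_even_of_four (by decide) (by decide) 16 32 (by decide +kernel)

/-- `957`: the even character `(·/957)` — truncation certificate `J = 16`, `P = 32` (`B = 2864`, worst cell margin `0.226`). [cite: Chua2005RealZeros, §2.2 ALGO 1] -/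
private theorem good957 :
    ∀ χ : DirichletCharacter ℂ 957, χ.IsQuadratic → χ.IsPrimitive → χ.Even →
      ∀ σ : ℝ, 0 < σ → σ < 1 → χ.LFunction σ ≠ 0 :=
  good_even_of_odd (by decide) (by decide) 16 32 (by decide +kernel)

/-- `965`: the even character `(·/965)` — truncation certificate `J = 16`, `P = 32` (`B = 2709`, worst cell margin `0.268`). [cite: Chua2005RealZeros, §2.2 ALGO 1] -/
private theorem good965 :
    ∀ χ : DirichletCharacter ℂ 965, χ.IsQuadratic → χ.IsPrimitive → χ.Even →
      ∀ σ : ℝ, 0 < σ → σ < 1 → χ.LFunction σ ≠ 0 :=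
  good_even_of_odd (by decide) (by decide) 16 32 (by decide +kernel)

/-- `969`: the even character `(·/969)` — truncation certificate `J = 16`, `P = 32` (`B = 3277`, worst cell margin `1.761`). [cite: Chua2005RealZeros, §2.2 ALGO 1] -/
private theorem good969 :
    ∀ χ : DirichletCharacter ℂ 969, χ.IsQuadratic → χ.IsPrimitive → χ.Even →
      ∀ σ : ℝ, 0 < σ → σ < 1 → χ.LFunction σ ≠ 0 :=
  good_even_of_odd (by decide) (by decide) 16 32 (by decide +kernel)

/-- `973`: the even character `(·/973)` — truncation certificate `J = 16`, `P = 32` (`B = 3350`, worst cell margin `0.696`). [cite: Chua2005RealZeros, §2.2 ALGO 1] -/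
private theorem good973 :
    ∀ χ : DirichletCharacter ℂ 973, χ.IsQuadratic → χ.IsPrimitive → χ.Even →
      ∀ σ : ℝ, 0 < σ → σ < 1 → χ.LFunction σ ≠ 0 :=
  good_even_of_odd (by decide) (by decide) 16 32 (by decide +kernel)

/-- `977`: the even character `(·/977)` — truncation certificate `J = 16`, `P = 32` (`B = 3198`, worst cell margin `1.173`). [cite: Chua2005RealZeros, §2.2 ALGO 1] -/
private theorem good977 :
    ∀ χ : DirichletCharacter ℂ 977, χ.IsQuadratic → χ.IsPrimitive → χ.Even →
      ∀ σ : ℝ, 0 < σ → σ < 1 → χ.LFunction σ ≠ 0 :=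
  good_even_of_odd (by decide) (by decide) 16 32 (by decide +kernel)

/-- `984 = 8·123`: the even character `χ₋₈·(·/123)` — truncation certificate `J = 16`, `P = 32` (`B = 3368`, worst cell margin `1.214`); the other primitive quadratic character mod `984` is odd (parity test). [cite: Chua2005RealZeros, §2.2 ALGO 1] -/
private theorem good984 :
    ∀ χ : DirichletCharacter ℂ 984, χ.IsQuadratic → χ.IsPrimitive → χ.Even →
      ∀ σ : ℝ, 0 < σ → σ < 1 → χ.LFunction σ ≠ 0 :=
  good_even_of_eight (by decide) (by decide) 16 32 (by decide +kernel) (by decide +kernel)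

/-- `985`: the even character `(·/985)` — truncation certificate `J = 16`, `P = 32` (`B = 3631`, worst cell margin `2.061`). [cite: Chua2005RealZeros, §2.2 ALGO 1] -/
private theorem good985 :
    ∀ χ : DirichletCharacter ℂ 985, χ.IsQuadratic → χ.IsPrimitive → χ.Even →
      ∀ σ : ℝ, 0 < σ → σ < 1 → χ.LFunction σ ≠ 0 :=
  good_even_of_odd (by decide) (by decide) 16 32 (by decide +kernel)

/-- `988 = 4·247`: the even character `χ₋₄·(·/247)` — truncation certificate `J = 16`, `P = 32` (`B = 3504`, worst cell margin `1.202`). [cite: Chua2005RealZeros, §2.2 ALGO 1] -/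
private theorem good988 :
    ∀ χ : DirichletCharacter ℂ 988, χ.IsQuadratic → χ.IsPrimitive → χ.Even →
      ∀ σ : ℝ, 0 < σ → σ < 1 → χ.LFunction σ ≠ 0 :=
  good_even_of_four (by decide) (by decide) 16 32 (by decide +kernel)

/-- `989`: the even character `(·/989)` — truncation certificate `J = 16`, `P = 32` (`B = 3010`, worst cell margin `0.547`). [cite: Chua2005RealZeros, §2.2 ALGO 1] -/
private theorem good989 :
    ∀ χ : DirichletCharacter ℂ 989, χ.IsQuadratic → χ.IsPrimitive → χ.Even →
      ∀ σ : ℝ, 0 < σ → σ < 1 → χ.LFunction σ ≠ 0 :=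
  good_even_of_odd (by decide) (by decide) 16 32 (by decide +kernel)

/-- `993`: the even character `(·/993)` — truncation certificate `J = 16`, `P = 32` (`B = 3354`, worst cell margin `1.280`). [cite: Chua2005RealZeros, §2.2 ALGO 1] -/
private theorem good993 :
    ∀ χ : DirichletCharacter ℂ 993, χ.IsQuadratic → χ.IsPrimitive → χ.Even →
      ∀ σ : ℝ, 0 < σ → σ < 1 → χ.LFunction σ ≠ 0 :=
  good_even_of_odd (by decide) (by decide) 16 32 (by decide +kernel)

/-- `997`: the even character `(·/997)` — truncation certificate `J = 16`, `P = 32` (`B = 3375`, worst cell margin `0.560`). [cite: Chua2005RealZeros, §2.2 ALGO 1] -/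
private theorem good997 :
    ∀ χ : DirichletCharacter ℂ 997, χ.IsQuadratic → χ.IsPrimitive → χ.Even →
      ∀ σ : ℝ, 0 < σ → σ < 1 → χ.LFunction σ ≠ 0 :=
  good_even_of_odd (by decide) (by decide) 16 32 (by decide +kernel)

/-- **No real zero in `(0, 1)` for every even real primitive character of conductor `951 ≤ q ≤ 1000`**
(one bullet per modulus, in the order of `interval_cases`). [cite: Chua2005RealZeros, §2.2 ALGO 1] -/
theorem range_951_1000 (q : ℕ) [NeZero q] (hlo : 950 < q) (hhi : q ≤ 1000) :
    ∀ χ : DirichletCharacter ℂ q, χ.IsQuadratic → χ.IsPrimitive → χ.Even →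
      ∀ σ : ℝ, 0 < σ → σ < 1 → χ.LFunction σ ≠ 0 := by
  interval_cases q
  · -- 951 ≡ 3 (mod 4): the primitive quadratic character (·/951) is odd (parity test)
    exact good_even_of_odd (by decide) (by decide) 16 32 (by decide +kernel)
  · exact good952 -- certificate
  · exact good953 -- certificate
  · -- 954 ≡ 2 (mod 4): no primitive character
    exact fun χ _ hprim _ ↦ (absurd_of_mod_four_two (by decide) hprim).elim
  · -- 955 ≡ 3 (mod 4): the primitive quadratic character (·/955) is odd (parity test)
    exact good_even_of_odd (by decide) (by decide) 16 32 (by decide +kernel)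
  · exact good956 -- certificate
  · exact good957 -- certificate
  · -- 958 ≡ 2 (mod 4): no primitive character
    exact fun χ _ hprim _ ↦ (absurd_of_mod_four_two (by decide) hprim).elim
  · -- 959 ≡ 3 (mod 4): the primitive quadratic character (·/959) is odd (parity test)
    exact good_even_of_odd (by decide) (by decide) 16 32 (by decide +kernel)
  · -- 16 ∣ 960: no primitive quadratic character
    exact fun χ hquad hprim _ ↦ (absurd_of_sixteen_dvd (by decide) hprim hquad).elim
  · -- 31² ∣ 961: no primitive quadratic character
    exact fun χ hquad hprim _ ↦
      (absurd_of_sq_dvd (p := 31) (by norm_num) (by decide) (by decide) hprim hquad).elim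
  · -- 962 ≡ 2 (mod 4): no primitive character
    exact fun χ _ hprim _ ↦ (absurd_of_mod_four_two (by decide) hprim).elim
  · -- 3² ∣ 963: no primitive quadratic character
    exact fun χ hquad hprim _ ↦
      (absurd_of_sq_dvd (p := 3) (by norm_num) (by decide) (by decide) hprim hquad).elim
  · -- 964 = 4·241, 241 ≡ 1 (mod 4): the primitive quadratic character is odd (parity test)
    exact good_even_of_four (by decide) (by decide) 16 32 (by decide +kernel)
  · exact good965 -- certificate
  · -- 966 ≡ 2 (mod 4): no primitive character
    exact fun χ _ hprim _ ↦ (absurd_of_mod_four_two (by decide) hprim).elim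
  · -- 967 ≡ 3 (mod 4): the primitive quadratic character (·/967) is odd (parity test)
    exact good_even_of_odd (by decide) (by decide) 16 32 (by decide +kernel)
  · -- 11² ∣ 968: no primitive quadratic character
    exact fun χ hquad hprim _ ↦
      (absurd_of_sq_dvd (p := 11) (by norm_num) (by decide) (by decide) hprim hquad).elim
  · exact good969 -- certificate
  · -- 970 ≡ 2 (mod 4): no primitive character
    exact fun χ _ hprim _ ↦ (absurd_of_mod_four_two (by decide) hprim).elim
  · -- 971 ≡ 3 (mod 4): the primitive quadratic character (·/971) is odd (parity test)
    exact good_even_of_odd (by decide) (by decide) 16 32 (by decide +kernel)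
  · -- 3² ∣ 972: no primitive quadratic character
    exact fun χ hquad hprim _ ↦
      (absurd_of_sq_dvd (p := 3) (by norm_num) (by decide) (by decide) hprim hquad).elim
  · exact good973 -- certificate
  · -- 974 ≡ 2 (mod 4): no primitive character
    exact fun χ _ hprim _ ↦ (absurd_of_mod_four_two (by decide) hprim).elim
  · -- 5² ∣ 975: no primitive quadratic character
    exact fun χ hquad hprim _ ↦
      (absurd_of_sq_dvd (p := 5) (by norm_num) (by decide) (by decide) hprim hquad).elim
  · -- 16 ∣ 976: no primitive quadratic character
    exact fun χ hquad hprim _ ↦ (absurd_of_sixteen_dvd (by decide) hprim hquad).elim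
  · exact good977 -- certificate
  · -- 978 ≡ 2 (mod 4): no primitive character
    exact fun χ _ hprim _ ↦ (absurd_of_mod_four_two (by decide) hprim).elim
  · -- 979 ≡ 3 (mod 4): the primitive quadratic character (·/979) is odd (parity test)
    exact good_even_of_odd (by decide) (by decide) 16 32 (by decide +kernel)
  · -- 7² ∣ 980: no primitive quadratic character
    exact fun χ hquad hprim _ ↦
      (absurd_of_sq_dvd (p := 7) (by norm_num) (by decide) (by decide) hprim hquad).elim
  · -- 3² ∣ 981: no primitive quadratic character
    exact fun χ hquad hprim _ ↦
      (absurd_of_sq_dvd (p := 3) (by norm_num) (by decide) (by decide) hprim hquad).elim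
  · -- 982 ≡ 2 (mod 4): no primitive character
    exact fun χ _ hprim _ ↦ (absurd_of_mod_four_two (by decide) hprim).elim
  · -- 983 ≡ 3 (mod 4): the primitive quadratic character (·/983) is odd (parity test)
    exact good_even_of_odd (by decide) (by decide) 16 32 (by decide +kernel)
  · exact good984 -- certificate
  · exact good985 -- certificate
  · -- 986 ≡ 2 (mod 4): no primitive character
    exact fun χ _ hprim _ ↦ (absurd_of_mod_four_two (by decide) hprim).elim
  · -- 987 ≡ 3 (mod 4): the primitive quadratic character (·/987) is odd (parity test)
    exact good_even_of_odd (by decide) (by decide) 16 32 (by decide +kernel)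
  · exact good988 -- certificate
  · exact good989 -- certificate
  · -- 990 ≡ 2 (mod 4): no primitive character
    exact fun χ _ hprim _ ↦ (absurd_of_mod_four_two (by decide) hprim).elim
  · -- 991 ≡ 3 (mod 4): the primitive quadratic character (·/991) is odd (parity test)
    exact good_even_of_odd (by decide) (by decide) 16 32 (by decide +kernel)
  · -- 16 ∣ 992: no primitive quadratic character
    exact fun χ hquad hprim _ ↦ (absurd_of_sixteen_dvd (by decide) hprim hquad).elim
  · exact good993 -- certificate
  · -- 994 ≡ 2 (mod 4): no primitive character
    exact fun χ _ hprim _ ↦ (absurd_of_mod_four_two (by decide) hprim).elim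
  · -- 995 ≡ 3 (mod 4): the primitive quadratic character (·/995) is odd (parity test)
    exact good_even_of_odd (by decide) (by decide) 16 32 (by decide +kernel)
  · -- 996 = 4·249, 249 ≡ 1 (mod 4): the primitive quadratic character is odd (parity test)
    exact good_even_of_four (by decide) (by decide) 16 32 (by decide +kernel)
  · exact good997 -- certificate
  · -- 998 ≡ 2 (mod 4): no primitive character
    exact fun χ _ hprim _ ↦ (absurd_of_mod_four_two (by decide) hprim).elim
  · -- 3² ∣ 999: no primitive quadratic character
    exact fun χ hquad hprim _ ↦
      (absurd_of_sq_dvd (p := 3) (by norm_num) (by decide) (by decide) hprim hquad).elim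
  · -- 5² ∣ 1000: no primitive quadratic character
    exact fun χ hquad hprim _ ↦
      (absurd_of_sq_dvd (p := 5) (by norm_num) (by decide) (by decide) hprim hquad).elim

end EvenTruncationVIb

open EvenTruncationVIb in
/-- **Even real primitive characters of conductor `951 ≤ q ≤ 1000` have no real zero in `(0, 1)`.**
[cite: Chua2005RealZeros, Theorem 1.1 (q ≤ 200 000, here re-proved in the kernel for this range)] -/
theorem noRealZeroEven_range_951_1000 (q : ℕ) [NeZero q] (hlo : 950 < q) (hhi : q ≤ 1000) :
    ∀ χ : DirichletCharacter ℂ q, χ.IsQuadratic → χ.IsPrimitive → χ.Even →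
      ∀ σ : ℝ, 0 < σ → σ < 1 → χ.LFunction σ ≠ 0 :=
  range_951_1000 q hlo hhi

end Literature.NumberTheory.LFunctions
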